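import Summits.QuantumFields.BalabanUV.Beta.FP.TowerDoorPeriodisedWindow

/-!
# `BalabanUV.Beta.FP.TowerDoorPeriodisedRegroup` — binder row D1, the row's ONE file, (T2) `hWΔT` part (D-b3) (J-NOTE-21 §5; v10 `FP/StepRecursionFeedNestedNamedI` l.217):
# **THE SOURCE-WOUND TORUS TABLE OF THE DOOR, GENERIC LETTERS — ASSEMBLED**: the lattice window sum regroups into the coarse box and its translates, the translates becoming SOURCE copies:
# `perZ T (dper T (x w ↦ Σ'_e doorZ … μ y ν (translate Mc y′ e) x w)) x w a b`
# `  = κΔ · Σ_κ Σ_{ȳ₀ ∈ pbox Mc} ((Σ'_e S ν (translate Mc y′ e) κ ȳ₀) · perZ T (dper T (defKerZ … Λ_(μ,y) (ȳ₀,κ))) x w a b + (Σ'_e S μ (translate Mc y e) κ ȳ₀) · perZ T (dper T (defKerZ … Λ_(ν,y′) (ȳ₀,κ))) x w a b)`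
# with the PERIODISED GAUGE FUNCTIONS `Λ_(μ,y) u := Σ'_e lam μ (translate Mc y e) u` — (T2) up to the three record identifications (PART 47 weight, the road's second socket (S2), PART 57 gauge)
# (β-function cell `pub-balaban`, BINDER-OWNERS row D1 ∕ (C1) OWNER «beta-an2» gen 78, PART 73; imports PART 72 ONLY)

WHY (located; J-NOTE-21 §5 steps (2)–(4), journal [AN2-G78-ONLINE] A-1 (i)).  After PART 72 §3, `perZ T ∘ dper T` of one direction's window superposition is
`Σ'_{y₀} (Ŝ′_(ν,y′)(y₀)·P(lam μ y, y₀) + S μ y κ y₀·P(Λ_(ν,y′), y₀))`, `P(v, y₀) := perZ T (dper T (defKerZ … v (y₀,κ))) x w a b`.  The window sum over `ℤ⁴` is `Σ_{ȳ₀ ∈ pbox Mc} Σ'_{m₁}`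
(road `tsum_sites_eq_sum_tsum`); on the second term the window translate is invisible (`Λ_(ν,y′)` is `T`-periodic, PART 72 `perZ_dper_defKerZ_window_translate_periodic`) and the weight's window
copies are its source copies (PART 72 `tsum_weight_window_eq_sources`); on the first term the weight is `Mc`-periodic in the window (PART 72 `tsum_weight_translate_window`), the window translate
is a SOURCE translate of the gauge function (PART 72 `perZ_dper_defKerZ_window_translate_lam`), and the source copies re-enter the gauge slot by PART 70 `perZ_dper_tsum_of_biLoc` backwards and
road (R3) `defKerZ_tsum`.

WHAT ([folklore] `tsum` bookkeeping BY NAME over PART 70∕71∕72 and road (R3); hypotheses = v10's record shapes `hlam hlamt hS hSt` + `hT : T i = L·Mc i`; no `def`, no `def … : Prop`, nothing cited, 0 sorry).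
* §1 `tsum_window_regroup` (one direction regrouped into the box); §2 **`perZ_dper_tsum_sources_doorZ`** (the display above: PART 71 `tsum_sources_doorZ_eq`, PART 70 `perZ_dper_const_mul ∕
  _finset_sum`, PART 72 §3, §1).
WHAT THIS IS NOT: not (T2) at the record (part (D-c): `𝒲Δ := doorRec …`, PART 47 for the weight, road (S2) `submatrix_perF_dper_defKerZ` for `perF T (dper T (defKerZ … Λ β̄))|ff`, PART 57 for `Λ ↔ lv`,
the scalar pin `κτ·cS = −(sn·cM₂·r)·(sn·r)`); nothing of Bałaban's asserted, valued or discharged; 0 estimates beyond existential bookkeeping constants; 0∕4 row-D1 binders (hW, hR, D1Tel, D1Rep);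
v10 NOT filed; v9 p617999 stands; NOT (C1), NOT (T-ID), NOT D1, NEVER «G-an2-4 closed», NOT BetaPertH, NOT continuum, NOT Clay.

HONEST DEPENDENCY (page 1, mandatory): continuum YM on T⁴ ⇐ BetaPertH ∧ nine spine estimates (0/9 proved); BetaPertH ⇐ (D1) ∧ (D4) ∧ CAP+tail;
G-an2-4 gates asym, D1 and NE2/3/4.  HONEST FRAMING (cell contract, verbatim): «discharging `BetaPertH` makes Bałaban's UV stability UNCONDITIONAL —
a real constructive-QFT result; it is NOT the continuum limit and NOT the Clay problem.»  ABSOLUTE RULE (cell charter, verbatim): «No internally-minted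
statement may enter as a cited fact. Every hypothesis is either kernel-proved in this package or a verbatim quotation of a PUBLISHED theorem with page
reference. The manuscript(s) under audit are NOT citable for their own disputed steps — they are the thing under adjudication; programme-internal
(2001/route/tribunal) claims are never citable.»  Row D1 ∕ (C1) OWNER «beta-an2» gen 78, 2026-08-29.  No existing file touched.
-/

noncomputable section

open Finset
open scoped BigOperators
open Literature.MathematicalPhysics.QuantumFieldTheory
open Literature.MathematicalPhysics.QuantumFieldTheory.Balaban1983to89
open Literature.MathematicalPhysics.QuantumFieldTheory.Balaban1983to89.Beta
open Literature.MathematicalPhysics.QuantumFieldTheory.Balaban1983to89.B12Sec2to5 (l1 l1_nonneg)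
open B4TorusKernel.MultiPeriod (translate translate_apply translate_injective)
open B4Reflection242 (translate_translate)
open B4Sect5Proof (latticeConst latticeConst_nonneg)
open B6Lemma24Torus (pbox)
open AffineAveraging (Site unitVec)
open OneStepResolventKernel (Fib)
open ExpKernelCalculus (MKer BiLoc)
open Summit.QuantumFields.BalabanUV.Beta.SymmetrisedStepJets (SymTables)
open Summit.QuantumFields.BalabanUV.Beta.FP.KernelPeriodisationFib (perZ)
open Summit.QuantumFields.BalabanUV.Beta.FP.KernelPeriodisationFibLoc (dper summable_exp_l1_translate)
open Summit.QuantumFields.BalabanUV.Beta.FP.KernelPeriodisationFibTrace (tsum_sites_eq_sum_tsum)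
open Summit.QuantumFields.BalabanUV.Beta.FP.TowerK2bDoorReadoutPeriodised (translate_smul_eq_smul_translate)
open Summit.QuantumFields.BalabanUV.Beta.FP.TowerDoorDefectDefs
open Summit.QuantumFields.BalabanUV.Beta.FP.TowerDoorDefectLinear (defKerZ_tsum)
open Summit.QuantumFields.BalabanUV.Beta.FP.TowerDoorPeriodisedLinear
open Summit.QuantumFields.BalabanUV.Beta.FP.TowerDoorPeriodisedSource
open Summit.QuantumFields.BalabanUV.Beta.FP.TowerDoorPeriodisedWindow

namespace Summit.QuantumFields.BalabanUV.Beta.FP.TowerDoorPeriodisedRegroup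

variable (L : ℕ) (tabs : SymTables 3 L) (κ₂ : ℝ)

/-! ## §1 The window sum regrouped into the coarse box: translates become source copies -/

section Regroup

variable {L}
variable (lam : Fin (3 + 1) → Site (3 + 1) → (Site (3 + 1) → ℝ)) (S : Fin (3 + 1) → Site (3 + 1) → Fin (3 + 1) → Site (3 + 1) → ℝ)
variable {K δv CS δS : ℝ}

/-- [folklore] **`tsum_window_regroup`** — ONE DIRECTION REGROUPED: with `P(v, y₀) := perZ T (dper T (defKerZ … v (y₀,κ))) x w a b` and `Λ_(μ,y) := Σ'_e lam μ (translate Mc y e)`,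
`Σ'_{y₀} (Ŝ′_(ν,y′)(y₀)·P(lam μ y, y₀) + S μ y κ y₀·P(Λ_(ν,y′), y₀)) = Σ_{ȳ₀ ∈ pbox Mc} (Ŝ′_(ν,y′)(ȳ₀)·P(Λ_(μ,y), ȳ₀) + Ŝ′_(μ,y)(ȳ₀)·P(Λ_(ν,y′), ȳ₀))`
(road `tsum_sites_eq_sum_tsum`; §2 on each translate; PART 70 §4 backwards + road (R3) `defKerZ_tsum` to re-sum the first term's source copies into `Λ_(μ,y)`). -/
theorem tsum_window_regroup [NeZero L] (Mc T : Fin (3 + 1) → ℕ) [∀ i, NeZero (Mc i)] [∀ i, NeZero (T i)] (hT : ∀ i, T i = L * Mc i)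
    (hK : 0 ≤ K) (hδv : 0 < δv) (hlam : ∀ μ y u, |lam μ y u| ≤ K * Real.exp (-δv * l1 (((L : ℕ) : ℤ) • y - u)))
    (hlamt : ∀ μ y u t, lam μ (y + t) (u + ((L : ℕ) : ℤ) • t) = lam μ y u)
    (hCS : 0 ≤ CS) (hδS : 0 < δS) (hS : ∀ ν z κ y₀, |S ν z κ y₀| ≤ CS * Real.exp (-δS * l1 (y₀ - z)))
    (hSt : ∀ ν z κ y₀ t, S ν (z + t) κ (y₀ + t) = S ν z κ y₀)
    (μ : Fin (3 + 1)) (y : Site (3 + 1)) (ν : Fin (3 + 1)) (y' : Site (3 + 1)) (κ : Fin (3 + 1)) (x w : Site (3 + 1)) (a b : Fib 3) :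
    ∑' y₀ : Site (3 + 1),
        ((∑' e : Site (3 + 1), S ν (translate Mc y' e) κ y₀) * perZ T (dper T (defKerZ L tabs κ₂ (lam μ y) (y₀, κ))) x w a b
          + S μ y κ y₀ * perZ T (dper T (defKerZ L tabs κ₂ (fun u => ∑' e : Site (3 + 1), lam ν (translate Mc y' e) u) (y₀, κ))) x w a b)
      = ∑ r : ↥(pbox Mc),
        ((∑' e : Site (3 + 1), S ν (translate Mc y' e) κ (r : Site (3 + 1)))
            * perZ T (dper T (defKerZ L tabs κ₂ (fun u => ∑' e : Site (3 + 1), lam μ (translate Mc y e) u) ((r : Site (3 + 1)), κ))) x w a b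
          + (∑' e : Site (3 + 1), S μ (translate Mc y e) κ (r : Site (3 + 1)))
            * perZ T (dper T (defKerZ L tabs κ₂ (fun u => ∑' e : Site (3 + 1), lam ν (translate Mc y' e) u) ((r : Site (3 + 1)), κ))) x w a b) := by
  obtain ⟨-, -, hs1, hs2⟩ := perZ_dper_window_tsum tabs κ₂ lam S Mc T hT hK hδv hlam hCS hδS hS μ y ν y' κ x w a b
  have hMc1 : ∀ i, 1 ≤ Mc i := fun i => Nat.one_le_iff_ne_zero.mpr (NeZero.ne (Mc i))
  obtain ⟨C, δm, hδm, hmix⟩ := tabs.hmix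
  rw [tsum_sites_eq_sum_tsum Mc (hs1.add hs2)]
  refine Finset.sum_congr rfl fun r _ => ?_
  have hs1r : Summable (fun m : Site (3 + 1) =>
      (∑' e : Site (3 + 1), S ν (translate Mc y' e) κ (translate Mc (r : Site (3 + 1)) m))
        * perZ T (dper T (defKerZ L tabs κ₂ (lam μ y) (translate Mc (r : Site (3 + 1)) m, κ))) x w a b) :=
    hs1.comp_injective (translate_injective hMc1 (r : Site (3 + 1)))
  have hs2r : Summable (fun m : Site (3 + 1) =>
      S μ y κ (translate Mc (r : Site (3 + 1)) m)
        * perZ T (dper T (defKerZ L tabs κ₂ (fun u => ∑' e : Site (3 + 1), lam ν (translate Mc y' e) u) (translate Mc (r : Site (3 + 1)) m, κ))) x w a b) :=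
    hs2.comp_injective (translate_injective hMc1 (r : Site (3 + 1)))
  rw [hs1r.tsum_add hs2r]
  congr 1
  · -- the `μ`-source term: the weight is `Mc`-periodic in the window, the window translate is a source translate, the copies re-enter the gauge slot
    have hper : ∀ m : Site (3 + 1),
        (∑' e : Site (3 + 1), S ν (translate Mc y' e) κ (translate Mc (r : Site (3 + 1)) m))
            * perZ T (dper T (defKerZ L tabs κ₂ (lam μ y) (translate Mc (r : Site (3 + 1)) m, κ))) x w a b
          = (∑' e : Site (3 + 1), S ν (translate Mc y' e) κ (r : Site (3 + 1)))
              * perZ T (dper T (defKerZ L tabs κ₂ (lam μ (translate Mc y (-m))) ((r : Site (3 + 1)), κ))) x w a b := by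
      intro m
      rw [tsum_weight_translate_window S Mc hSt, perZ_dper_defKerZ_window_translate_lam tabs κ₂ lam Mc T hT hlamt]
    rw [tsum_congr hper, tsum_mul_left]
    congr 1
    -- `Σ'_m P(lam μ (translate Mc y (−m)), r) = Σ'_e P(lam μ (translate Mc y e), r) = P(Λ_(μ,y), r)`
    have hneg := (Equiv.neg (Site (3 + 1))).tsum_eq (fun e : Site (3 + 1) =>
      perZ T (dper T (defKerZ L tabs κ₂ (lam μ (translate Mc y e)) ((r : Site (3 + 1)), κ))) x w a b)
    simp only [Equiv.neg_apply] at hneg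
    rw [hneg]
    obtain ⟨ρ₁, A₁, hρ₁, hA₁, hD₁⟩ := exists_biLoc_defKerZ_lam L tabs κ₂ hK hδv hlam
    have hCe : Summable (fun e : Site (3 + 1) => A₁ * Real.exp (-(ρ₁ / 2) * l1 (((L : ℕ) : ℤ) • translate Mc y e - ((L : ℕ) : ℤ) • (r : Site (3 + 1))))) := by
      obtain ⟨hs, -⟩ := summable_exp_l1_translate T (half_pos hρ₁) (((L : ℕ) : ℤ) • (r : Site (3 + 1))) (((L : ℕ) : ℤ) • y)
      refine (hs.mul_left A₁).congr fun e => ?_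
      rw [translate_smul_eq_smul_translate L T Mc hT y e]
    rw [← perZ_dper_tsum_of_biLoc T (W := fun e : Site (3 + 1) => defKerZ L tabs κ₂ (lam μ (translate Mc y e)) ((r : Site (3 + 1)), κ))
      (fun e => hD₁ μ (translate Mc y e) ((r : Site (3 + 1)), κ)) (fun e => by positivity) (by positivity) hCe x w a b]
    have habs : ∀ u : Site (3 + 1), Summable (fun e : Site (3 + 1) => |lam μ (translate Mc y e) u|) :=
      fun u => (summable_abs_lam_sources Mc T hT hK hδv hlam μ y u).1
    have hV : ∀ u : Site (3 + 1), ∑' e : Site (3 + 1), |lam μ (translate Mc y e) u| ≤ K * latticeConst (3 + 1) δv :=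
      fun u => (summable_abs_lam_sources Mc T hT hK hδv hlam μ y u).2
    have hker : (fun x' w' a' b' => ∑' e : Site (3 + 1), defKerZ L tabs κ₂ (lam μ (translate Mc y e)) ((r : Site (3 + 1)), κ) x' w' a' b')
        = defKerZ L tabs κ₂ (fun u => ∑' e : Site (3 + 1), lam μ (translate Mc y e) u) ((r : Site (3 + 1)), κ) := by
      funext x' w' a' b'
      exact (defKerZ_tsum L tabs hmix hδm κ₂ habs hV ((r : Site (3 + 1)), κ) x' w' a' b').symm
    rw [hker]
  · -- the `ν`-source term: the window translate is invisible (`Λ` is `T`-periodic), the weight's window copies are its source copies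
    have hper : ∀ m : Site (3 + 1),
        S μ y κ (translate Mc (r : Site (3 + 1)) m)
            * perZ T (dper T (defKerZ L tabs κ₂ (fun u => ∑' e : Site (3 + 1), lam ν (translate Mc y' e) u) (translate Mc (r : Site (3 + 1)) m, κ))) x w a b
          = S μ y κ (translate Mc (r : Site (3 + 1)) m)
              * perZ T (dper T (defKerZ L tabs κ₂ (fun u => ∑' e : Site (3 + 1), lam ν (translate Mc y' e) u) ((r : Site (3 + 1)), κ))) x w a b := by
      intro m
      rw [perZ_dper_defKerZ_window_translate_periodic tabs κ₂ Mc T hT (fun u m' => tsum_lam_sources_sub_period lam Mc hlamt ν y' u m')]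
    rw [tsum_congr hper, tsum_mul_right, tsum_weight_window_eq_sources S Mc hSt]

end Regroup

/-! ## §2 The source-wound torus table of the door, generic letters -/

section Main

variable {L}
variable (κΔ : ℝ) (lam : Fin (3 + 1) → Site (3 + 1) → (Site (3 + 1) → ℝ)) (S : Fin (3 + 1) → Site (3 + 1) → Fin (3 + 1) → Site (3 + 1) → ℝ)
variable {K δv CS δS : ℝ}

/-- [folklore] **`perZ_dper_tsum_sources_doorZ` — (T2)'s LEFT SIDE IN GENERIC LETTERS**: for a block-covariant, exponentially localised gauge-function family `lam`, a covariant, exponentially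
decaying read-out weight `S`, the coarse box `Mc` and the torus `T = L•Mc`,
`perZ T (dper T (x w ↦ Σ'_e doorZ L tabs κ₂ κΔ lam S μ y ν (translate Mc y′ e) x w)) x w a b`
`  = κΔ · Σ_κ Σ_{ȳ₀ ∈ pbox Mc} ((Σ'_e S ν (translate Mc y′ e) κ ȳ₀) · perZ T (dper T (defKerZ L tabs κ₂ (Σ'_e lam μ (translate Mc y e)) (ȳ₀,κ))) x w a b`
`                          + (Σ'_e S μ (translate Mc y e) κ ȳ₀) · perZ T (dper T (defKerZ L tabs κ₂ (Σ'_e lam ν (translate Mc y′ e)) (ȳ₀,κ))) x w a b)`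
(PART 71 `tsum_sources_doorZ_eq`; PART 70 `perZ_dper_const_mul ∕ _finset_sum`; PART 72 §3; §1). -/
theorem perZ_dper_tsum_sources_doorZ [NeZero L] (Mc T : Fin (3 + 1) → ℕ) [∀ i, NeZero (Mc i)] [∀ i, NeZero (T i)] (hT : ∀ i, T i = L * Mc i)
    (hK : 0 ≤ K) (hδv : 0 < δv) (hlam : ∀ μ y u, |lam μ y u| ≤ K * Real.exp (-δv * l1 (((L : ℕ) : ℤ) • y - u)))
    (hlamt : ∀ μ y u t, lam μ (y + t) (u + ((L : ℕ) : ℤ) • t) = lam μ y u)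
    (hCS : 0 ≤ CS) (hδS : 0 < δS) (hS : ∀ ν z κ y₀, |S ν z κ y₀| ≤ CS * Real.exp (-δS * l1 (y₀ - z)))
    (hSt : ∀ ν z κ y₀ t, S ν (z + t) κ (y₀ + t) = S ν z κ y₀)
    (μ : Fin (3 + 1)) (y : Site (3 + 1)) (ν : Fin (3 + 1)) (y' : Site (3 + 1)) (x w : Site (3 + 1)) (a b : Fib 3) :
    perZ T (dper T (fun x' w' a' b' => ∑' e : Site (3 + 1), doorZ L tabs κ₂ κΔ lam S μ y ν (translate Mc y' e) x' w' a' b')) x w a b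
      = κΔ * ∑ κ : Fin (3 + 1), ∑ r : ↥(pbox Mc),
        ((∑' e : Site (3 + 1), S ν (translate Mc y' e) κ (r : Site (3 + 1)))
            * perZ T (dper T (defKerZ L tabs κ₂ (fun u => ∑' e : Site (3 + 1), lam μ (translate Mc y e) u) ((r : Site (3 + 1)), κ))) x w a b
          + (∑' e : Site (3 + 1), S μ (translate Mc y e) κ (r : Site (3 + 1)))
            * perZ T (dper T (defKerZ L tabs κ₂ (fun u => ∑' e : Site (3 + 1), lam ν (translate Mc y' e) u) ((r : Site (3 + 1)), κ))) x w a b) := by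
  rw [tsum_sources_doorZ_eq tabs κ₂ κΔ lam S Mc T hT hK hδv hlam hCS hδS hS μ y ν y']
  have hwin := fun κ : Fin (3 + 1) => perZ_dper_window_tsum tabs κ₂ lam S Mc T hT hK hδv hlam hCS hδS hS μ y ν y' κ x w a b
  calc perZ T (dper T (fun x' w' a' b' => κΔ * ∑ κ : Fin (3 + 1), ∑' y₀ : Site (3 + 1),
          ((∑' e : Site (3 + 1), S ν (translate Mc y' e) κ y₀) * defKerZ L tabs κ₂ (lam μ y) (y₀, κ) x' w' a' b'
            + S μ y κ y₀ * defKerZ L tabs κ₂ (fun u => ∑' e : Site (3 + 1), lam ν (translate Mc y' e) u) (y₀, κ) x' w' a' b'))) x w a b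
      = κΔ * perZ T (dper T (fun x' w' a' b' => ∑ κ ∈ (Finset.univ : Finset (Fin (3 + 1))),
          (fun κ => fun x'' w'' a'' b'' => ∑' y₀ : Site (3 + 1),
            ((∑' e : Site (3 + 1), S ν (translate Mc y' e) κ y₀) * defKerZ L tabs κ₂ (lam μ y) (y₀, κ) x'' w'' a'' b''
              + S μ y κ y₀ * defKerZ L tabs κ₂ (fun u => ∑' e : Site (3 + 1), lam ν (translate Mc y' e) u) (y₀, κ) x'' w'' a'' b'')) κ x' w' a' b')) x w a b :=
        perZ_dper_const_mul T κΔ _ x w a b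
    _ = κΔ * ∑ κ : Fin (3 + 1), perZ T (dper T (fun x'' w'' a'' b'' => ∑' y₀ : Site (3 + 1),
            ((∑' e : Site (3 + 1), S ν (translate Mc y' e) κ y₀) * defKerZ L tabs κ₂ (lam μ y) (y₀, κ) x'' w'' a'' b''
              + S μ y κ y₀ * defKerZ L tabs κ₂ (fun u => ∑' e : Site (3 + 1), lam ν (translate Mc y' e) u) (y₀, κ) x'' w'' a'' b''))) x w a b := by
        rw [perZ_dper_finset_sum T Finset.univ _ x w a b (fun κ _ => (hwin κ).2.1)]
    _ = _ := by
        congr 1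
        refine Finset.sum_congr rfl fun κ _ => ?_
        rw [(hwin κ).1]
        exact tsum_window_regroup tabs κ₂ lam S Mc T hT hK hδv hlam hlamt hCS hδS hS hSt μ y ν y' κ x w a b

end Main

end Summit.QuantumFields.BalabanUV.Beta.FP.TowerDoorPeriodisedRegroup

end
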